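import Summits.QuantumFields.YangMills.Theorems.AllWindowsColdBoxBoxHighLineLandauThirdOrder
import Summits.QuantumFields.YangMills.Theorems.AllWindowsColdBoxBoxHighLineLandauRung3Compositions

/-!
# LINE-20 «landau-rung3»: the FULL REACH of the third-order line as unconditional tree theorems — every window `θ ≤ θL`, every `θL < 1/10`

Planner ym-idea-2 g19 GO 2026-08-30T03:05:34Z («it records the line's TRUE reach … as ONE unconditional tree theorem»); LEAD seat
ym-line-sfw-p2 g79 (free hands).  With the two cut-set sizes landed — hK3 = ✓`tiltCum3_cutSet_size₀` (fcl-p3 g27, ✓p757674, over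
✓p757110 `K3RowSum.tiltCum3_cutSet_size`) and hK4 = ✓`tiltCum4_cutSet_size` (w4 g30, ✓p755305) — w2 g33's conditional compositions
✓`LandauRung3.landauRelativeComparisonBulk_of_sizes` / `boxTwoPointDomination_of_sizes` (✓p754558, U1–U4 by name inside) become:

* (U5 with its four Landau hypotheses discharged by name is ✓`LandauRung3.landauRelativeComparisonBulk_of_sizes tiltCum3_cutSet_size₀
  tiltCum4_cutSet_size` — cited, not restated: the gate's dedup lint identifies the instantiation with the landed conditional theorem);
* `boxTwoPointDomination_thirdOrder : 0 < A → A < θ → θ < 1/10 → ∃ c > 0, BoxTwoPointDomination A θ c` — the SU(2) cold-box two-point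
  domination at EVERY single window below `1/10` (bulk currency ✓`boxWindow_of_dirichletDominationBulk_ceiling`);
* ★`boxWindowUpTo_thirdOrder : ∀ θL < 1/10, BoxWindowUpToSU22 θL` — every window `θ ≤ θL` (no lower cut), the honest full reach of LINE-20;
* `boxWindow_of_hi_lt_tenth : hi < 1/10 → BoxWindowSU22 lo hi` — in particular the sliver `(1/11, hi]`, `hi < 1/10`, which the wording of the
  declared residual ⟨stmt-QuantumFields-25584⟩ `BoxWindowHighSU2211` («θ > 1/11») leaves unrecorded on the ledger (no item is filed for it:
  planner ruling 03:05:34Z — a θ₁-tweak of ⟨25584⟩ carries no mathematics).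

HONEST LABEL: corollaries of landed theorems, nothing analytic is new here; the MID item ⟨stmt-QuantumFields-25580⟩ is closed by fcl-p3's `_holds`
(in flight), not by this file; ⟨25584⟩ (θ > 1/11, RG/Bałaban class, attacked by no line), hence ⟨24336⟩ and ⟨24004⟩, remain OPEN; route
AllWindowsColdBox DRAFT; the windows below 1/10 are a RECORD-type one-scale weak-coupling result, not a rung and not a summit conjunct;
**the Yang–Mills mass gap is NOT proved by this file; no summit is proved by a line.**
-/

set_option autoImplicit false

noncomputable section

open Summit.QuantumFields.YangMills.Theorems.WeakCouplingRates

namespace Summit.QuantumFields.YangMills.Theorems.AllWindowsColdBoxBoxHighLine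

namespace LandauRung3

/-- **Cold-box two-point domination for SU(2) at every single window below `1/10`**: for `0 < A < θ < 1/10` there is `c > 0` with
`BoxTwoPointDomination A θ c`. -/
theorem boxTwoPointDomination_thirdOrder (A θ : ℝ) (hA : 0 < A) (hAθ : A < θ) (hθ : θ < 1 / 10) :
    ∃ c : ℝ, 0 < c ∧ BoxTwoPointDomination (G := SU2) (Literature.MathematicalPhysics.QuantumLattice.fundamentalRep (Fin 2)) A θ c :=
  boxTwoPointDomination_of_sizes tiltCum3_cutSet_size₀ tiltCum4_cutSet_size (θL := θ) hθ A θ hA hAθ le_rfl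

/-- ★ **The full reach of LINE-20**: every window `θ ≤ θL`, for every `θL < 1/10` (the skeleton's `boxWindowUpTo_of` with U1–U5 by name). -/
theorem boxWindowUpTo_thirdOrder : ∀ θL : ℝ, θL < 1 / 10 → BoxWindowUpToSU22 θL :=
  fun _θL hθL A θ hA hAθ hθ => boxTwoPointDomination_of_sizes tiltCum3_cutSet_size₀ tiltCum4_cutSet_size hθL A θ hA hAθ hθ

/-- Every window `(lo, hi]` with `hi < 1/10`, in the LINE-20 letters — in particular the sliver `(1/11, hi]` above the MID item. -/
theorem boxWindow_of_hi_lt_tenth (lo hi : ℝ) (hhi : hi < 1 / 10) : BoxWindowSU22 lo hi :=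
  fun A θ hA hAθ _h7 _hlo hθ => boxTwoPointDomination_of_sizes tiltCum3_cutSet_size₀ tiltCum4_cutSet_size hhi A θ hA hAθ hθ

/-- The residual above `1/11` reduces to the residual above any `hi < 1/10`: `BoxWindowHighSU22 hi → BoxWindowHighSU22 (1/11)`
(so ⟨stmt-QuantumFields-25584⟩'s open content is exactly the windows `θ ≥ 1/10`, up to the choice of `hi`). -/
theorem boxWindowHigh11_of_high (hi : ℝ) (hhi : hi < 1 / 10) (hres : BoxWindowHighSU22 hi) : BoxWindowHighSU22 (1 / 11) := by
  intro A θ hA hAθ h7 _h11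
  by_cases hθ : θ ≤ hi
  · exact boxTwoPointDomination_of_sizes tiltCum3_cutSet_size₀ tiltCum4_cutSet_size hhi A θ hA hAθ hθ
  · exact hres A θ hA hAθ h7 (lt_of_not_ge hθ)

end LandauRung3

end Summit.QuantumFields.YangMills.Theorems.AllWindowsColdBoxBoxHighLine

end
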